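import Summits.QuantumFields.BalabanUV.Beta.BorderedHessianKernel

/-!
# The undressed bordered Hessian kernel `bhK N`, file 2 of 2: representation of `d*d`, `𝒬ᵀ_N`, `𝒬_N` by the entries and the
# ACTION LEMMAS `comp (bhK N) X` (β sub-cell, row BETA-an2, gen 13)

HONEST FRAMING (cell charter, verbatim): «discharging BetaPertH makes Balaban's UV stability UNCONDITIONAL — a real
constructive-QFT result; it is NOT the continuum limit and NOT the Clay problem.»  DERIVED cell leaf (pub-balaban β sub-cell, lane
an2 gen 13); no statement of Bałaban's papers is typed here, no `[cite:]` tag, no `Prop` fact; it instantiates no binder of the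
β-function wall by itself.  NOT `BetaPertH`; NOT continuum; NOT Clay.

## What is here
* §3 REPRESENTATION of the three lattice operators by the entries of `bhK N`: `curvAdj_curv_eq_window_sum`
  (`(d*d A)_κ(x) = Σ_{v ∈ cube 2} Σ_l (d*d δ_{(l,x+v)})_κ(x) A_l(x+v)` — locality radius `2` + linearity of `KernelSpecInstance.opEL`),
  `hasSum_contourSumAdj_delta`, `hasSum_contourSum_delta` (sums of point-supported functions);
* §4 the columns `fcol X z b` (fine 1-form `l, y ↦ X y z (inl l) b`) and `mcol N X z b` (coarse 1-form `l, y′ ↦ X (N•y′) z (inr l) b`) of a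
  kernel and **THE ACTION LEMMAS**, for ANY kernel `X` (the rows of `bhK N` are finitely supported; no summability hypothesis):
  `comp_bhK_inl : comp (bhK N) X x z (inl κ) b = (d*d (fcol X z b))_κ(x) − (𝒬ᵀ_N (mcol N X z b))_κ(x)`,
  `comp_bhK_inr : comp (bhK N) X x z (inr κ) b = [proj N x = 0]·(𝒬_N (fcol X z b))_κ(quo N x)`.
Consumers (same lane, gen 13): `BorderedHessianSymmetry`, `BorderedHessianBlind`, `BorderedHessianResidual`, `RelInvBorderedHessian`.

All declarations `[folklore]` (finite sums, point-supported lattice sums, linearity of the cell's lattice operators); axioms standard.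
Provenance: b2b-balaban β sub-cell, unit beta-an2 gen 13, 2026-08-20 (v1); over file 1, `KernelSpecInstance` (`opEL`),
`ResolventComposition.tsum_sublattice₀`, `AxialDressingRootedKernel.tsum_window` BY NAME; no existing file touched.
-/
open Finset
open scoped BigOperators
open Literature.Probability.LatticeModels (TorusSite Torus.proj Torus.proj_apply)
open Literature.MathematicalPhysics.QuantumFieldTheory
open Literature.MathematicalPhysics.QuantumFieldTheory.Balaban1983to89
open Literature.MathematicalPhysics.QuantumFieldTheory.Balaban1983to89.Beta
open B12Sec2to5 (l1 l1_nonneg)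
open ExpKernelCalculus (MKer Decays BiLoc comp tr shiftK)
open AffineAveraging (Form0 Form1 Form2 box toSite unitVec unitVec_apply dz curv curvAdj codiff₁ contourSum)
open AffineReproduction (contourSumAdj)
open LatticeForm (quo)
open KKTFluctuationKernel (delta1 delta1_apply)
open KKTFluctuationEnergy (contourSumAdj_eq abs_curv_le abs_contourSumAdj_le)
open KernelSpecInstance (opEL curv_add curv_smul curvAdj_add curvAdj_smul)
open OneStepResolventKernel (Fib quo_zsmul eq_zsmul_quo_of_proj proj_zsmul)
open AxialProjector (zsmul_blk_le lt_zsmul_blk_add)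
open Summit.QuantumFields.BalabanUV.Beta.TameKernelCalculus
open Summit.QuantumFields.BalabanUV.Beta.AxialDressingRooted (cube mem_cube zero_mem_cube l1_le_of_mem_cube tsum_window)

namespace Summit.QuantumFields.BalabanUV.Beta.BorderedHessian

noncomputable section

/-! ## §3 Representation of `d*d`, `𝒬ᵀ_N`, `𝒬_N` by the entries -/

section Rep

variable {d : ℕ}

/-- [folklore] `opEL A = curvAdj (curv A)`. -/
theorem opEL_apply (A : Form1 (d + 1) ℝ) : opEL A = curvAdj (curv A) := rfl

/-- [folklore] **`d*d` IS REPRESENTED BY ITS WINDOWED MATRIX**: for every 1-form `A`,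
`(d*d A)_κ(x) = Σ_{v ∈ cube 2} Σ_l (d*d δ_{(l, x+v)})_κ(x) · A_l(x + v)` (locality radius `2` + linearity). -/
theorem curvAdj_curv_eq_window_sum (A : Form1 (d + 1) ℝ) (κ : Fin (d + 1)) (x : Fin (d + 1) → ℤ) :
    curvAdj (curv A) κ x = ∑ v ∈ cube (d + 1) 2, ∑ l : Fin (d + 1), curvAdj (curv (delta1 l (x + v))) κ x * A l (x + v) := by
  classical
  -- the window truncation of `A` as a finite combination of indicators
  set A' : Form1 (d + 1) ℝ := ∑ v ∈ cube (d + 1) 2, ∑ l : Fin (d + 1), A l (x + v) • delta1 l (x + v) with hA'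
  have hagree : ∀ l, ∀ v ∈ cube (d + 1) 2, A l (x + v) = A' l (x + v) := by
    intro l v hv
    rw [hA', Finset.sum_apply, Finset.sum_apply]
    simp only [Finset.sum_apply, Pi.smul_apply, smul_eq_mul, delta1_apply]
    rw [Finset.sum_eq_single v]
    · rw [Finset.sum_eq_single l]
      · simp
      · intro l' _ hl'
        rw [if_neg (fun h => hl' h.1.symm), mul_zero]
      · intro h; exact absurd (Finset.mem_univ l) h
    · intro v' _ hv'
      refine Finset.sum_eq_zero fun l' _ => ?_
      rw [if_neg (fun h => hv' (add_left_cancel h.2).symm), mul_zero]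
    · intro h; exact absurd hv h
  rw [curvAdj_curv_congr hagree κ]
  -- linearity of `d*d` over the finite combination
  have hlin : curvAdj (curv A') = ∑ v ∈ cube (d + 1) 2, ∑ l : Fin (d + 1), A l (x + v) • curvAdj (curv (delta1 l (x + v))) := by
    rw [← opEL_apply, hA', map_sum]
    refine Finset.sum_congr rfl fun v _ => ?_
    rw [map_sum]
    refine Finset.sum_congr rfl fun l _ => ?_
    rw [map_smul]
    rfl
  rw [hlin, Finset.sum_apply, Finset.sum_apply]
  refine Finset.sum_congr rfl fun v _ => ?_
  rw [Finset.sum_apply, Finset.sum_apply]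
  refine Finset.sum_congr rfl fun l _ => ?_
  simp only [Pi.smul_apply, smul_eq_mul]
  ring

/-- [folklore] Fibre contraction of an indicator coefficient: `Σ_l [c = l ∧ p = y] · g l = [p = y] · g c`. -/
theorem sum_ite_and_mul (c : Fin (d + 1)) (p y : Fin (d + 1) → ℤ) (g : Fin (d + 1) → ℝ) :
    ∑ l : Fin (d + 1), (if c = l ∧ p = y then (1 : ℝ) else 0) * g l = if p = y then g c else 0 := by
  by_cases hp : p = y
  · simp only [hp, and_true, if_true]
    rw [Finset.sum_eq_single c (fun l _ hl => by rw [if_neg (Ne.symm hl), zero_mul]) (fun h => absurd (Finset.mem_univ c) h)]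
    simp
  · simp [hp]

/-- [folklore] **`𝒬ᵀ_N` IS REPRESENTED BY ITS MATRIX**: for every coarse 1-form `ψ`,
`Σ'_{y′} Σ_l (𝒬ᵀ_N δ_{(l,y′)})_κ(x) · ψ_l(y′)` converges to `(𝒬ᵀ_N ψ)_κ(x)` (a sum of `N` point-supported functions of `y′`). -/
theorem hasSum_contourSumAdj_delta (N : ℕ) (ψ : Form1 (d + 1) ℝ) (κ : Fin (d + 1)) (x : Fin (d + 1) → ℤ) :
    HasSum (fun y' : Fin (d + 1) → ℤ => ∑ l : Fin (d + 1), contourSumAdj N (delta1 l y') κ x * ψ l y')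
      (contourSumAdj N ψ κ x) := by
  have e : ∀ y', ∑ l : Fin (d + 1), contourSumAdj N (delta1 l y') κ x * ψ l y' =
      ∑ s ∈ Finset.range N, (if quo N (x - (s : ℤ) • unitVec κ) = y' then ψ κ y' else 0) := by
    intro y'
    simp only [contourSumAdj_eq, delta1_apply, Finset.sum_mul]
    rw [Finset.sum_comm]
    refine Finset.sum_congr rfl fun s _ => ?_
    exact sum_ite_and_mul κ _ y' (fun l => ψ l y')
  simp_rw [e]
  rw [contourSumAdj_eq]
  refine hasSum_sum fun s _ => ?_
  have h := hasSum_ite_eq (quo N (x - (s : ℤ) • unitVec κ)) (ψ κ (quo N (x - (s : ℤ) • unitVec κ)))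
  convert h using 2 with y'
  by_cases hy : quo N (x - (s : ℤ) • unitVec κ) = y'
  · subst hy; simp
  · rw [if_neg hy, if_neg (Ne.symm hy)]

/-- [folklore] **`𝒬_N` IS REPRESENTED BY ITS MATRIX**: for every fine 1-form `A`,
`Σ'_y Σ_l (𝒬_N δ_{(l,y)})_κ(q) · A_l(y)` converges to `(𝒬_N A)_κ(q)` (a sum of `N^{d+2}` point-supported functions of `y`). -/
theorem hasSum_contourSum_delta (N : ℕ) (A : Form1 (d + 1) ℝ) (κ : Fin (d + 1)) (q : Fin (d + 1) → ℤ) :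
    HasSum (fun y : Fin (d + 1) → ℤ => ∑ l : Fin (d + 1), contourSum N (delta1 l y) κ q * A l y) (contourSum N A κ q) := by
  have e : ∀ y, ∑ l : Fin (d + 1), contourSum N (delta1 l y) κ q * A l y =
      ∑ b ∈ box (d + 1) N, ∑ s ∈ Finset.range N,
        (if (N : ℤ) • q + toSite b + (s : ℤ) • unitVec κ = y then A κ y else 0) := by
    intro y
    simp only [AffineAveraging.contourSum, delta1_apply, Finset.sum_mul]
    rw [Finset.sum_comm]
    refine Finset.sum_congr rfl fun b _ => ?_
    rw [Finset.sum_comm]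
    refine Finset.sum_congr rfl fun s _ => ?_
    exact sum_ite_and_mul κ _ y (fun l => A l y)
  simp_rw [e]
  unfold AffineAveraging.contourSum
  refine hasSum_sum fun b _ => hasSum_sum fun s _ => ?_
  have h := hasSum_ite_eq ((N : ℤ) • q + toSite b + (s : ℤ) • unitVec κ) (A κ ((N : ℤ) • q + toSite b + (s : ℤ) • unitVec κ))
  convert h using 2 with y
  by_cases hy : (N : ℤ) • q + toSite b + (s : ℤ) • unitVec κ = y
  · subst hy; simp
  · rw [if_neg hy, if_neg (Ne.symm hy)]

/-- [folklore] **THE WINDOW OF THE FIELD–FIELD ENTRY IS REDUNDANT**: `(d*d δ_{(β,z)})_κ(x) = 0` unless `z − x ∈ cube 2` (the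
representation lemma read on an indicator). -/
theorem curvAdj_curv_delta1_eq_zero {x z : Fin (d + 1) → ℤ} (h : z - x ∉ cube (d + 1) 2) (κ β : Fin (d + 1)) :
    curvAdj (curv (delta1 β z)) κ x = 0 := by
  rw [curvAdj_curv_eq_window_sum]
  refine Finset.sum_eq_zero fun v hv => Finset.sum_eq_zero fun l _ => ?_
  rw [delta1_apply, if_neg, mul_zero]
  rintro ⟨-, hxv⟩
  exact h (by rw [← hxv]; simpa using hv)

/-- [folklore] The field–field entry of `bhK N` without its window: `bhK N x z (inl κ) (inl β) = (d*d δ_{(β,z)})_κ(x)`. -/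
theorem bhK_inl_inl_eq (N : ℕ) (x z : Fin (d + 1) → ℤ) (κ β : Fin (d + 1)) :
    bhK N x z (Sum.inl κ) (Sum.inl β) = curvAdj (curv (delta1 β z)) κ x := by
  rw [bhK_inl_inl]
  split_ifs with h
  · rfl
  · rw [curvAdj_curv_delta1_eq_zero h]

end Rep

/-! ## §4 The action lemmas: `bhK N ∘ X` in terms of `d*d`, `𝒬ᵀ_N`, `𝒬_N` applied to the columns of `X` -/

section Action

variable {d : ℕ} (N : ℕ)

/-- [folklore] The FIELD COLUMN of a kernel `X` at `(z, b)`, read as a fine 1-form: `l, y ↦ X y z (inl l) b`. -/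
def fcol (X : MKer (d + 1) (Fib d)) (z : Fin (d + 1) → ℤ) (b : Fib d) : Form1 (d + 1) ℝ := fun l y => X y z (Sum.inl l) b

/-- [folklore] The MULTIPLIER COLUMN of a kernel `X` at `(z, b)`, read as a coarse 1-form: `l, y′ ↦ X (N•y′) z (inr l) b`. -/
def mcol (X : MKer (d + 1) (Fib d)) (z : Fin (d + 1) → ℤ) (b : Fib d) : Form1 (d + 1) ℝ :=
  fun l y' => X ((N : ℤ) • y') z (Sum.inr l) b

/-- [folklore] Entries of `fcol`. -/
@[simp] theorem fcol_apply (X : MKer (d + 1) (Fib d)) (z : Fin (d + 1) → ℤ) (b : Fib d) (l : Fin (d + 1)) (y : Fin (d + 1) → ℤ) :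
    fcol X z b l y = X y z (Sum.inl l) b := rfl

/-- [folklore] Entries of `mcol`. -/
@[simp] theorem mcol_apply (X : MKer (d + 1) (Fib d)) (z : Fin (d + 1) → ℤ) (b : Fib d) (l : Fin (d + 1)) (y' : Fin (d + 1) → ℤ) :
    mcol N X z b l y' = X ((N : ℤ) • y') z (Sum.inr l) b := rfl

/-- [folklore] The field–field part of a row of `bhK N ∘ X`: the windowed matrix sum is `(d*d X_{·zb})_κ(x)`. -/
theorem tsum_bhK_inl_inl (X : MKer (d + 1) (Fib d)) (x z : Fin (d + 1) → ℤ) (κ : Fin (d + 1)) (b : Fib d) :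
    ∑' y, ∑ l : Fin (d + 1), bhK N x y (Sum.inl κ) (Sum.inl l) * X y z (Sum.inl l) b = curvAdj (curv (fcol X z b)) κ x := by
  have e : ∀ y, ∑ l : Fin (d + 1), bhK N x y (Sum.inl κ) (Sum.inl l) * X y z (Sum.inl l) b =
      if y - x ∈ cube (d + 1) 2 then ∑ l : Fin (d + 1), curvAdj (curv (delta1 l y)) κ x * X y z (Sum.inl l) b else 0 := by
    intro y
    simp only [bhK_inl_inl]
    split_ifs
    · rfl
    · simp
  simp_rw [e]
  rw [tsum_window, curvAdj_curv_eq_window_sum]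
  rfl

/-- [folklore] The field–multiplier part of a row of `bhK N ∘ X`: `−(𝒬ᵀ_N X^c_{·zb})_κ(x)`. -/
theorem tsum_bhK_inl_inr [NeZero N] (X : MKer (d + 1) (Fib d)) (x z : Fin (d + 1) → ℤ) (κ : Fin (d + 1)) (b : Fib d) :
    ∑' y, ∑ l : Fin (d + 1), bhK N x y (Sum.inl κ) (Sum.inr l) * X y z (Sum.inr l) b = -contourSumAdj N (mcol N X z b) κ x := by
  rw [ResolventComposition.tsum_sublattice₀ N
    (fun y => ∑ l : Fin (d + 1), bhK N x y (Sum.inl κ) (Sum.inr l) * X y z (Sum.inr l) b)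
    (fun y' => -(∑ l : Fin (d + 1), contourSumAdj N (delta1 l y') κ x * X ((N : ℤ) • y') z (Sum.inr l) b))
    (fun w hw => Finset.sum_eq_zero fun l _ => by rw [bhK_inl_inr, if_neg hw, zero_mul])
    (fun w' => by
      rw [← Finset.sum_neg_distrib]
      refine Finset.sum_congr rfl fun l _ => ?_
      rw [bhK_inl_inr, if_pos (proj_zsmul w'), quo_zsmul, neg_mul]),
    tsum_neg]
  exact congrArg Neg.neg (hasSum_contourSumAdj_delta N (mcol N X z b) κ x).tsum_eq

/-- [folklore] The multiplier–field part of a row of `bhK N ∘ X` at a coarse `x`: `(𝒬_N X_{·zb})_κ(quo x)`. -/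
theorem tsum_bhK_inr_inl {x : Fin (d + 1) → ℤ} (hx : Torus.proj N x = 0) (X : MKer (d + 1) (Fib d)) (z : Fin (d + 1) → ℤ)
    (κ : Fin (d + 1)) (b : Fib d) :
    ∑' y, ∑ l : Fin (d + 1), bhK N x y (Sum.inr κ) (Sum.inl l) * X y z (Sum.inl l) b = contourSum N (fcol X z b) κ (quo N x) := by
  simp only [bhK_inr_inl, if_pos hx]
  exact (hasSum_contourSum_delta N (fcol X z b) κ (quo N x)).tsum_eq

/-- [folklore] **ACTION LEMMA, FIELD ROWS**: `(bhK N ∘ X)(x, z, inl κ, b) = (d*d X_{·zb})_κ(x) − (𝒬ᵀ_N X^c_{·zb})_κ(x)` — for ANY kernel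
`X` (the row of `bhK N` is finitely supported; no summability hypothesis). -/
theorem comp_bhK_inl [NeZero N] (X : MKer (d + 1) (Fib d)) (x z : Fin (d + 1) → ℤ) (κ : Fin (d + 1)) (b : Fib d) :
    comp (bhK N) X x z (Sum.inl κ) b = curvAdj (curv (fcol X z b)) κ x - contourSumAdj N (mcol N X z b) κ x := by
  unfold ExpKernelCalculus.comp
  have e : ∀ y, ∑ f : Fib d, bhK N x y (Sum.inl κ) f * X y z f b =
      (∑ l : Fin (d + 1), bhK N x y (Sum.inl κ) (Sum.inl l) * X y z (Sum.inl l) b) +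
        ∑ l : Fin (d + 1), bhK N x y (Sum.inl κ) (Sum.inr l) * X y z (Sum.inr l) b := fun y => Fintype.sum_sum_type _
  simp_rw [e]
  have s1 : Summable fun y => ∑ l : Fin (d + 1), bhK N x y (Sum.inl κ) (Sum.inl l) * X y z (Sum.inl l) b := by
    refine summable_of_ne_finset_zero (s := (cube (d + 1) 2).image fun v => x + v) fun y hy => ?_
    have hy' : y - x ∉ cube (d + 1) 2 := fun h => hy (Finset.mem_image.2 ⟨y - x, h, by abel⟩)
    simp [bhK_inl_inl, hy']
  have s2 : Summable fun y => ∑ l : Fin (d + 1), bhK N x y (Sum.inl κ) (Sum.inr l) * X y z (Sum.inr l) b := by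
    refine summable_of_ne_finset_zero (s := (cube (d + 1) (2 * N)).image fun v => x + v) fun y hy => ?_
    have hy' : y - x ∉ cube (d + 1) (2 * N) := fun h => hy (Finset.mem_image.2 ⟨y - x, h, by abel⟩)
    refine Finset.sum_eq_zero fun l _ => ?_
    rw [bhK_eq_zero_of_not_mem_cube (Nat.one_le_iff_ne_zero.mpr (NeZero.ne N)) hy', zero_mul]
  rw [s1.tsum_add s2, tsum_bhK_inl_inl, tsum_bhK_inl_inr, sub_eq_add_neg]

/-- [folklore] **ACTION LEMMA, MULTIPLIER ROWS**: `(bhK N ∘ X)(x, z, inr κ, b) = [proj N x = 0]·(𝒬_N X_{·zb})_κ(quo N x)`. -/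
theorem comp_bhK_inr [NeZero N] (X : MKer (d + 1) (Fib d)) (x z : Fin (d + 1) → ℤ) (κ : Fin (d + 1)) (b : Fib d) :
    comp (bhK N) X x z (Sum.inr κ) b = if Torus.proj N x = 0 then contourSum N (fcol X z b) κ (quo N x) else 0 := by
  unfold ExpKernelCalculus.comp
  have e : ∀ y, ∑ f : Fib d, bhK N x y (Sum.inr κ) f * X y z f b =
      ∑ l : Fin (d + 1), bhK N x y (Sum.inr κ) (Sum.inl l) * X y z (Sum.inl l) b := fun y => by
    rw [Fintype.sum_sum_type]
    simp [bhK_inr_inr]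
  simp_rw [e]
  split_ifs with hx
  · exact tsum_bhK_inr_inl N hx X z κ b
  · simp [bhK_inr_inl, hx]

end Action

end

end Summit.QuantumFields.BalabanUV.Beta.BorderedHessian
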